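import Mathlib
import HarnessLib
import Summits.HubbardSuperconductivity.HubbardSuperconductivity.Theorems.ComplexGFFStiffnessHypACumulantTunedRepresentation

/-!
# Crux `HypACumulant`, line `gnv` — `pertZ n 𝒦 ≠ 0` from the [ABKM19] package at fixed `(L, N)`

Route `route-HubbardSuperconductivity-ComplexGFFStiffness`, crux item stmt-HubbardSuperconductivity-19154,
research stub `stub_gnvOfFrd : TorusFRD 4 → GNV`.  This file combines
`…TunedRepresentation.exists_iota_tuned_representation` (an `ι`-Hamiltonian `ℋ⋆` with
`‖∫ (e^{−ℋ⋆} ∘_0 K̂_0)(Λ) dμ^{(q(ℋ⋆))} − 1‖ ≤ εη^N A⁻¹ A_𝒫`) with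
`…TunedRepresentation.pertZ_ne_zero_of_representation` at `d = 4`:

* **`pertZ_ne_zero_of_package`** — under the hypotheses of [ABKM19] Lemma 12.6 for the torus data
  `(ℤ/L^N)^4` (package form: the finite-range decomposition clauses for every elliptic `A`, the weight
  bounds of Theorem 7.1, the side conditions of Theorem 6.8 and of Ch. 12, an `ι`-admissible `𝒦`),
  `pertZ M 𝒦 ≠ 0`.

What remains for `GNV` is the `N`-uniform CHOICE of these parameters (`…HypACumulantGNV`).  All proved.

## References
* S. Adams, S. Buchholz, R. Kotecký, S. Müller, arXiv:1910.13564, Theorem 2.2 (representation half),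
  Ch. 4.4, Ch. 12 [AdamsBuchholzKoteckyMuller2019].
-/

noncomputable section

-- `Summit.<Summit>.<Problem>`: single-conjunct summit, the duplicate component is mandated (D-0017).
set_option linter.dupNamespace false

namespace Summit.HubbardSuperconductivity.HubbardSuperconductivity.Theorems.ComplexGFF

open scoped BigOperators ComplexConjugate
open Real Set Finset MeasureTheory
open Literature.MathematicalPhysics.StatisticalMechanics.GradientRG
open Literature.MathematicalPhysics.StatisticalMechanics.GradientFRD
  (fourierCoeff cExt cExt_of_mem IsElliptic IsUnitSymm InShell iterDiff supNorm conv ellOp isElliptic_one)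
open Literature.MathematicalPhysics.StatisticalMechanics.TorusPolymer
  (IsPolymer numBlocks blockOf boxCorner isPolymer_blockOf isConn_blockOf pcirc)
open Literature.Barriers.CriticalPhenomena.LongRangePhi4.Polymer (IsConn components)
open Literature.MathematicalPhysics.QuantumFieldTheory
open Literature.Dynamics.Hyperbolic

variable {M : ℕ} [NeZero M]

section Package

variable {L N Mord R n ñ : ℕ} {θbar lam μ δ₁ δ₀ A𝒫 : ℝ}
    {𝒞 : Matrix (Fin 4) (Fin 4) ℝ → ℕ → (Fin 4 → ZMod M) → ℝ} {Mc : ℕ → ℝ}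
    {Cα : (Fin 4 → ℕ) → ℕ → ℝ} {c C : ℝ} {Cℓ : ℕ → ℝ}

set_option maxHeartbeats 1600000 in
/-- **`pertZ M 𝒦 ≠ 0` under the [ABKM19] package at fixed `(L, N)`** (module docstring). -/
theorem pertZ_ne_zero_of_package {h : ℝ} [Fact (0 < h)] [Fact (0 < L)]
    (hMord : 1 ≤ Mord) (hMR : Mord ≤ R) (hLodd : Odd L) (hL : 2 ^ (4 + 3) + 16 * R ≤ L)
    (hR2 : 2 ≤ R) (hM : M = L ^ N)
    (hθbar : 0 < θbar) (hlam : 0 < lam) (hn : 2 * Mord ≤ n) (hn2 : 2 ≤ n) (hnñ : n ≤ ñ)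
    (hc : 0 < c) (hC1 : 0 ≤ Cℓ 1)
    (hallA : ∀ A : Matrix (Fin 4) (Fin 4) ℝ, IsElliptic (1 / 2 : ℝ) 2 A →
        (∀ k, 1 ≤ k → k ≤ N + 1 →
          ∑ x : Fin 4 → ZMod M, 𝒞 A k x = 0 ∧ ∀ x, 𝒞 A k (-x) = 𝒞 A k x) ∧
        (∀ k, 1 ≤ k → k ≤ N + 1 → ∀ φ : (Fin 4 → ZMod M) → ℝ, ∑ x, φ x = 0 →
          0 ≤ ∑ x, ∑ y, φ x * 𝒞 A k (x - y) * φ y) ∧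
        (∀ φ : (Fin 4 → ZMod M) → ℝ, ∑ x, φ x = 0 →
          ellOp A (conv (fun x => ∑ k ∈ Finset.Icc 1 (N + 1), 𝒞 A k x) φ) = φ) ∧
        (∀ k, 1 ≤ k → k ≤ N → Mc k ≤ 0 ∧
          ∀ x : Fin 4 → ZMod M, ((L : ℝ) ^ k) / 2 ≤ (supNorm x : ℝ) →
            𝒞 A k x = Mc k) ∧
        (∀ k, 1 ≤ k → k ≤ N + 1 → ∀ B : Matrix (Fin 4) (Fin 4) ℝ, IsUnitSymm B →
          (∃ ε : ℝ, 0 < ε ∧ ∀ x : Fin 4 → ZMod M,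
            ContDiffOn ℝ ⊤ (fun s : ℝ => 𝒞 (A + s • B) k x) (Set.Ioo (-ε) ε)) ∧
          ∀ α : Fin 4 → ℕ, ∑ i, α i ≤ n → ∀ ℓ : ℕ, ∀ x : Fin 4 → ZMod M,
            abs (iteratedDeriv ℓ (fun s : ℝ => iterDiff α (𝒞 (A + s • B) k) x) 0)
              ≤ Cα α ℓ / (L : ℝ) ^ ((k - 1) * (4 - 2 + ∑ i, α i))) ∧
        (∀ k, 1 ≤ k → k ≤ N + 1 → ∀ j : ℕ, ∀ κ : Fin 4 → ZMod M, κ ≠ 0 → InShell L j κ →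
          (j < k →
            c / (L : ℝ) ^ (2 * (4 + ñ) + 1) * (L : ℝ) ^ (2 * j)
                / (L : ℝ) ^ ((k - j) * (4 - 1 + n)) ≤ (fourierCoeff (𝒞 A k) κ).re ∧
            ‖fourierCoeff (𝒞 A k) κ‖
              ≤ C * (L : ℝ) ^ (2 * (4 + ñ) + 1) * (L : ℝ) ^ (2 * j)
                  / (L : ℝ) ^ ((k - j) * (4 - 1 + n))) ∧
          (k ≤ j →
            c / (L : ℝ) ^ (2 * (4 + ñ) + 1) * (L : ℝ) ^ (2 * k)
                ≤ (fourierCoeff (𝒞 A k) κ).re ∧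
            ‖fourierCoeff (𝒞 A k) κ‖ ≤ C * (L : ℝ) ^ (2 * k)) ∧
          ∀ B : Matrix (Fin 4) (Fin 4) ℝ, IsUnitSymm B → ∀ ℓ : ℕ, 1 ≤ ℓ →
            (j < k →
              ‖iteratedDeriv ℓ (fun s : ℝ => fourierCoeff (𝒞 (A + s • B) k) κ) 0‖
                ≤ Cℓ ℓ * (L : ℝ) ^ (2 * (4 + ñ) + 1) * (L : ℝ) ^ (2 * j)
                    / (L : ℝ) ^ ((k - j) * (4 - 1 + ñ))) ∧
            (k ≤ j →
              ‖iteratedDeriv ℓ (fun s : ℝ => fourierCoeff (𝒞 (A + s • B) k) κ) 0‖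
                ≤ Cℓ ℓ * (L : ℝ) ^ (2 * k))))
    (hB : AbkmWeightBounds L N Mord R n θbar lam μ δ₁ δ₀ A𝒫 (fun j => 𝒞 1 j)
      (abkmWeightData L N Mord R θbar (schedDelta δ₀ δ₁ N) fun j => 𝒞 1 j))
    {pT r₀ : ℕ} (hp : 4 / 2 + 2 ≤ pT) (hpM : pT + 4 ≤ Mord) (hr₀ : 3 ≤ r₀)
    (hδ₀ : 0 < δ₀) (hδ₁ : 0 < δ₁) (hh0 : hZeroSq 4 R δ₀ δ₁ ≤ h ^ 2)
    (hh2 : secondDiffConst (fun θ' => Cα θ' 0) ≤ h ^ 2)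
    -- the tuning ball
    {θ : ℝ} (hθ0 : 0 ≤ θ) (hθ : θ < θbar)
    {T₀ : ℝ} (hT₀ : T₀ ≤ 1 / 2) (hKT₀ : shellRatioConst c (Cℓ 1) (L : ℝ) 4 ñ * T₀ ≤ Real.log (1 + θ))
    {A𝒫' : ℝ} (hA𝒫' : weightIntConstRho θbar θ (traceConst 4 Mord R lam (derivSum 4 n fun θ' _ => Cα θ' 0)) = A𝒫')
    -- the side conditions of Theorem 6.8 (`RGStepABKMQ`), at `A_𝒫' = A_𝒫(θ)`
    {A : ℝ} (hA1 : 1 ≤ A) (hA𝒫A : A𝒫' ≤ A)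
    (hsmall : (2 : ℝ) ^ (L ^ 4) * (A𝒫' * A ^ (-(1 - (1 + 1 / ((2 * (2 ^ 4 + 1) + 6 : ℝ) ^ 4))⁻¹) : ℝ)) ≤ 1)
    {r : ℝ} (hr0 : 0 ≤ r) (hr : r ≤ 1 / 64)
    (hv : vABKM 4 R A A𝒫' r ≤ 1 / 64) (hωA : omegaABKM 4 R A A𝒫' r * A ^ 2 ≤ 1)
    (hc3A : (kappaABKM 4 R A A𝒫' r) ^ (L ^ 4) * ((2 * (2 * (kappaABKM 4 R A A𝒫' r) * max 1 A𝒫')) ^ ((2 ^ (4 + 1) + 2) ^ 4 * L ^ 4) * (4 : ℝ) ^ ((2 ^ (4 + 1) + 2) ^ 4 * L ^ 4)) ≤ A ^ ((1 + 1 / ((2 * (2 ^ 4 + 1) + 6 : ℝ) ^ 4)) - 1 : ℝ))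
    (hc2A : (kappaABKM 4 R A A𝒫' r) ^ (L ^ 4) * ((2 * (kappaABKM 4 R A A𝒫' r) * max 1 A𝒫') ^ ((2 ^ (4 + 1) + 2) ^ 4 * L ^ 4) * (2 : ℝ) ^ ((2 ^ (4 + 1) + 2) ^ 4 * L ^ 4)) ≤ A ^ ((1 + 1 / ((2 * (2 ^ 4 + 1) + 6 : ℝ) ^ 4)) - 1 : ℝ))
    -- the contraction regime of Ch. 12
    {η κ ε ρ : ℝ} (hη : 0 < η) (hη1 : η ≤ 1)
    (hκ₁ : (3 / 4 : ℝ) * (η + (L : ℝ) ^ 4 * (pi2BoundConst 4 (((2 * R + 2 : ℕ) : ℝ) + ((4 / 2 + 1 : ℕ) : ℝ)) * (A𝒫' * A⁻¹))) ≤ κ)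
    (hκ₂ : sigmaABKM 4 L R A A𝒫' r ≤ κ * η) (hκ : κ < 1)
    (hε : 0 ≤ ε) (hεr : ε ≤ r) (hερ : ε ≤ ρ) (hρ16 : ρ ≤ 1 / 16)
    -- the initial perturbation
    {𝒦 : (Fin 4 → ℝ) → ℂ} {ρ𝒦 : ℝ} (h𝒦 : ContDiff ℝ r₀ 𝒦)
    (h𝒦b : ∀ s, s ≤ r₀ → ∀ z : Fin 4 → ℝ, ‖iteratedFDeriv ℝ s 𝒦 z‖ ≤ ρ𝒦 * Real.exp ((∑ i, z i ^ 2) / 4))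
    (h𝒦small : (Real.exp (1 / 4) + 2 * Real.exp (3 / 8)) *
      (ρ𝒦 * Real.exp (fieldWt h (L : ℝ) 4 0 / (L : ℝ) ^ 0)) * A ≤ 1 / 2)
    (h𝒦ε : Real.exp (1 / 4) * (ρ𝒦 * Real.exp (fieldWt h (L : ℝ) 4 0 / (L : ℝ) ^ 0)) * A ≤ ε)
    (h𝒦ι : ∀ z, 𝒦 (-z) = conj (𝒦 z))
    -- the tuning map
    -- the two extra conditions of the flow identity / tuning map
    (hp4 : 4 * pT ≤ 2 ^ (4 + 2))
    (hqT₀ : 2 * (4 : ℝ) ^ 2 / (((L ^ (4 * 0) : ℕ) : ℝ) * (fieldWt h (L : ℝ) 4 0 / (L : ℝ) ^ 0) ^ 2) * ρ ≤ T₀) :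
    pertZ M 𝒦 ≠ 0 := by
  have hd : 3 ≤ 4 := by norm_num
  have hρ0 : 0 ≤ ρ := hε.trans hερ
  have hA : 0 < A := by linarith
  have hA𝒫0 : 0 ≤ A𝒫' := by
    rw [← hA𝒫']
    exact zero_le_one.trans (one_le_weightIntConstRho hθbar hθ0 hθ
      (traceConst_nonneg 4 Mord R hlam.le (derivSum_nonneg 4 n _)))
  obtain ⟨x₀, hι, hx₀ρ, hbound⟩ := exists_iota_tuned_representation (d := 4) (h := h) hd hMord hMR hLodd hL hR2 hM hθbar
    hlam hn hn2 hnñ hc hC1 hallA hB hp hpM hr₀ hδ₀ hδ₁ hh0 hh2 hθ0 hθ hT₀ hKT₀ hA𝒫' hA1 hA𝒫A hsmall hr0 hr hv hωA hc3A hc2A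
    hη hη1 hκ₁ hκ₂ hκ hε hεr hερ hρ16 h𝒦 h𝒦b h𝒦small h𝒦ε h𝒦ι hp4 hqT₀
  -- the quadratic form of `ℋ⋆` is small: `𝟙 + q(ℋ⋆)` is elliptic
  have hqT : ∑ i, ∑ j, |hamQuadForm (HamSpace.toHam x₀) i j| ≤ 1 / 2 := by
    rw [← hamTuningMap_of_le hx₀ρ]
    exact ((entrySum_hamTuningMap_le hρ0 x₀).trans hqT₀).trans hT₀
  have hell : IsElliptic (1 / 2 : ℝ) 2 ((1 : Matrix (Fin 4) (Fin 4) ℝ) + hamQuadForm (HamSpace.toHam x₀)) :=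
    isElliptic_one_add_hamQuadForm hqT
  obtain ⟨h1o, h1i, h1ii, -⟩ := hallA 1 isElliptic_one
  obtain ⟨hqo, hqi, hqii, -⟩ := hallA _ hell
  have hbound' : ‖(∫ φ, pcirc 1 (fun V => expNegH (HamSpace.toHam x₀) V φ)
      (fun U => initKH 𝒦 (HamSpace.toHam x₀) U φ) Finset.univ
        ∂(tailMeasure (fun j => 𝒞 ((1 : Matrix (Fin 4) (Fin 4) ℝ) + hamQuadForm (HamSpace.toHam x₀)) j) N N)) - 1‖ < 1 := by
    refine hbound.trans_lt ?_
    have hηN : η ^ N ≤ 1 := pow_le_one₀ hη.le hη1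
    have hAA : A⁻¹ * A𝒫' ≤ 1 := by
      rw [inv_mul_le_iff₀ hA]; linarith
    calc ε * η ^ N * A⁻¹ * A𝒫' = ε * η ^ N * (A⁻¹ * A𝒫') := by ring
      _ ≤ ε * 1 * 1 := by gcongr
      _ < 1 := by linarith
  exact pertZ_ne_zero_of_representation (n := M) (N := N) (ofReal_re_quad_of_isIotaHam hι)
    (fun k hk => (h1o k (Finset.mem_Icc.1 hk).1 (Finset.mem_Icc.1 hk).2).1)
    (fun k hk => (h1o k (Finset.mem_Icc.1 hk).1 (Finset.mem_Icc.1 hk).2).2)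
    (fun k hk => h1i k (Finset.mem_Icc.1 hk).1 (Finset.mem_Icc.1 hk).2) h1ii
    (fun k hk => (hqo k (Finset.mem_Icc.1 hk).1 (Finset.mem_Icc.1 hk).2).1)
    (fun k hk => (hqo k (Finset.mem_Icc.1 hk).1 (Finset.mem_Icc.1 hk).2).2)
    (fun k hk => hqi k (Finset.mem_Icc.1 hk).1 (Finset.mem_Icc.1 hk).2) hqii
    h𝒦.continuous hbound'

end Package

end Summit.HubbardSuperconductivity.HubbardSuperconductivity.Theorems.ComplexGFF

end
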